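import Summits.QuantumAdvantage.QuantumAdvantage.Theorems.MobiusLadderLiouvilleOrthogonalTC0StubSmallMajSim
import Summits.QuantumAdvantage.QuantumAdvantage.Theorems.MobiusLadderLiouvilleOrthogonalAC0
import HarnessLib

/-!
# Crux `MobiusLadder.LiouvilleOrthogonalTC0` (stmt-QuantumAdvantage-1393): majority gates of
logarithmic fan-in do not help — the small-fan-in rung, unconditionally

Line `Sketch` (lead `prover-line-stmt-QuantumAdvantage-1393-c2-0`). A circuit over `tcBasis` all of
whose majority gates `MAJₖ` have `2^k ≤ n^{c₀}` (fan-in `k ≤ c₀ log₂ n`) is simulated by a circuit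
over `acBasis` of at most twice the `acDepth` and size `≤ size · (n^{c₀} + 1)` (`stub_smallMajSim`:
`MAJₖ` = the depth-two DNF over the `C(k,⌈k/2⌉) ≤ 2^k` majority subsets), so the tree's PROVED `AC⁰`
rung (`Theorems.LiouvilleOrthogonalAC0_proof`, Green 2012) at depth `2d` and size polynomial
`p · (X^{c₀} + 1)` applies.

* `liouville_orthogonal_smallMaj` — for all `c₀ d p ε`, eventually in `n`, every circuit over
  `tcBasis` with `acDepth ≤ d`, `size ≤ p(n)` and all majority fan-ins `k` with `2^k ≤ n^{c₀}` has
  `|Σ_{N<2ⁿ} λ(N) sgn C(bits N)| ≤ ε 2ⁿ` (registered stub `stub_smallMaj`).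

Consequently the open residue of the line (`stub_hyp_pos`) concerns circuits of depth `≥ 2` with a
majority gate of SUPER-LOGARITHMIC fan-in and size growing with `n`.
-/

set_option linter.dupNamespace false -- D-0017: single-problem summit ⇒ `QuantumAdvantage.QuantumAdvantage` by design

noncomputable section

namespace Summit.QuantumAdvantage.QuantumAdvantage.Theorems.LiouvilleOrthogonalTC0

open Filter Finset
open Literature.Computability.Complexity
open Literature.Probability.RandomGraphs.LowDegree (sgn)

/-- **`λ` is orthogonal to constant-depth polynomial-size threshold circuits whose majority gates
have logarithmic fan-in** (unconditional): for all `c₀`, `d`, `p` and `ε > 0`, for all sufficiently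
large `n`, every circuit `C` on the `n` binary digits over `tcBasis` with `acDepth ≤ d`,
`size ≤ p(n)`, and `2^k ≤ n^{c₀}` for every majority gate `MAJₖ` of `C`, satisfies
`|Σ_{N<2ⁿ} λ(N) · sgn (C(bits N))| ≤ ε · 2ⁿ`. -/
theorem liouville_orthogonal_smallMaj (c₀ d : ℕ) (p : Polynomial ℕ) : ∀ ε : ℝ, 0 < ε →
    ∀ᶠ n : ℕ in atTop, ∀ C : Circuit (Fin n), C.IsOver tcBasis →
      (∀ g ∈ C.gates, ∀ k : ℕ, g.fn = GateFn.maj k → 2 ^ k ≤ n ^ c₀) →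
        C.acDepth ≤ d → C.size ≤ p.eval n →
          |∑ N ∈ Finset.range (2 ^ n), ((ArithmeticFunction.liouville N : ℤ) : ℝ) *
              sgn (C.eval (fun i : Fin n => Nat.testBit N i))| ≤ ε * (2 : ℝ) ^ n := by
  intro ε hε
  have hAC := Summit.QuantumAdvantage.QuantumAdvantage.Theorems.LiouvilleOrthogonalAC0_proof
  unfold Summit.QuantumAdvantage.QuantumAdvantage.Theses.MobiusLadder.LiouvilleOrthogonalAC0 at hAC
  filter_upwards [hAC (2 * d) (p * (Polynomial.X ^ c₀ + 1)) ε hε] with n hn C hB hM hd hs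
  obtain ⟨C', hB', hd', hs', heval⟩ := stub_smallMajSim (n ^ c₀) C hB hM
  have hsize : C'.size ≤ (p * (Polynomial.X ^ c₀ + 1)).eval n := by
    rw [Polynomial.eval_mul, Polynomial.eval_add, Polynomial.eval_pow, Polynomial.eval_X,
      Polynomial.eval_one]
    exact hs'.trans (Nat.mul_le_mul_right _ hs)
  have hdepth : C'.acDepth ≤ 2 * d := hd'.trans (Nat.mul_le_mul_left 2 hd)
  have h := hn C' hB' hdepth hsize
  simp only [heval] at h
  exact h

/-- **Registered stub `stub_smallMaj`**: verbatim `liouville_orthogonal_smallMaj`. -/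
theorem stub_smallMaj (c₀ d : ℕ) (p : Polynomial ℕ) : ∀ ε : ℝ, 0 < ε → ∀ᶠ n : ℕ in atTop, ∀ C : Circuit (Fin n), C.IsOver tcBasis → (∀ g ∈ C.gates, ∀ k : ℕ, g.fn = GateFn.maj k → 2 ^ k ≤ n ^ c₀) → C.acDepth ≤ d → C.size ≤ p.eval n → |∑ N ∈ Finset.range (2 ^ n), ((ArithmeticFunction.liouville N : ℤ) : ℝ) * sgn (C.eval (fun i : Fin n => Nat.testBit N i))| ≤ ε * (2 : ℝ) ^ n :=
  liouville_orthogonal_smallMaj c₀ d p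

end Summit.QuantumAdvantage.QuantumAdvantage.Theorems.LiouvilleOrthogonalTC0
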